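import Literature.Analysis.FluidPDE.LagrangianLatticeCarrier
import Literature.Analysis.ODE.TorusFlowJacobian
import Literature.Analysis.FunctionSpaces.TorusSpectralWeakDerivative
import Literature.Analysis.FunctionSpaces.TorusFourierCalculus
import Literature.Analysis.FunctionSpaces.TorusTrigPoly
import Literature.Analysis.FunctionSpaces.TorusCalculusProofs
import HarnessLib

/-!
# The `H¹` chain rule on the torus through a smooth measure-preserving self-map `X = id + proj ∘ D`,
# and its instance for the window flows of a regular Lagrangian lattice carrier

Analysis proof-support file (everything proved; no definitions, no named facts).

* `Torus.HasWeakPartialDeriv.comp_add_proj` — **`H¹` chain rule**: let `D : 𝕋^d → ℝ^d` be smooth and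
  let the torus self-map `X y = y + proj (D y)` be measure preserving. If `ψ ∈ L²(𝕋^d; ℝ^d)` has weak
  partial derivatives `gₐ ∈ L²` (`Torus.HasWeakPartialDeriv a ψ gₐ`, Evans §5.2.1), then `ψ ∘ X ∈ L²`
  (`Torus.memLp_comp_add_proj`) and `ψ ∘ X` has the weak partial derivatives
  `y ↦ Σₐ (δ_{aj} + ∂ⱼDₐ(y)) • gₐ(X y)` — the classical formula `∂ⱼ(ψ∘X) = Σₐ ∂ⱼXₐ (∂ₐψ)∘X`
  (Evans 2010, §5.2.3 Thm 1 (approximation by smooth functions) with the classical chain rule; cf.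
  Ziemer, *Weakly Differentiable Functions*, Thm 2.2.2 for bi-Lipschitz changes of variables).
  Proof: approximate `ψ` by its Fourier truncations `P_Nψ` (smooth, `P_Nψ → ψ` in `L²`,
  `Torus.tendsto_eLpNorm_fourierTruncate_sub`); the weak derivative has coefficients
  `𝓕(gₐ)(k) = 2πikₐ ψ̂(k)` (Evans §5.8 Thm 8 step 1, `mFourierCoeff_eq_of_hasWeakPartialDeriv`, copied
  here in complexified form), so `∂ₐP_Nψ = P_N gₐ` a.e. (Parseval) and `∂ₐP_Nψ → gₐ` in `L²`; the
  classical chain rule through `X` (`TorusFlow.partialDeriv_comp_add_proj`) and integration by parts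
  (`IsSmooth.hasWeakPartialDeriv`) give the weak identity for `P_Nψ ∘ X`; composition with the
  measure-preserving `X` is an `L²` isometry (`eLpNorm_comp_measurePreserving`) and `∂ⱼD` is bounded,
  so both sides of the weak identity pass to the limit (`tendsto_integral_of_L1`).
* `LagrangianLatticeCarrier.frameChainRule` — the instance for the coarse window flow `E.X m t s`
  (`= id + proj ∘ E.disp m t s`, smooth and measure preserving under `E.Regular`) with the derivative
  read as `E.flowDeriv m t s y = 1 + D(lift (E.disp m t s))(repr y)`: weak partials of `ψ ∘ E.X m t s`
  are `y ↦ Σₐ (E.flowDeriv m t s y eⱼ)ₐ • gₐ (E.X m t s y)` (brick Z5 `frameChainRule_text` of the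
  one-level design memo L7/L8 of cell `ad-ideate`, stmt-AnomalousDissipation-27980, in its binder shape).

## Mathlib / tree search

Tree: `TorusTestFunction` (`HasWeakPartialDeriv`, `IsSmooth.hasWeakPartialDeriv`, `IsSmooth.integrable_smul`),
`TorusCalculusProofs` (`integral_partialDeriv_eq_zero_holds`), `TorusFourierCalculus` (`partialDeriv_mFourier`,
`partialDeriv_clm_comp`, `mFourierCoeff_eq_integral_volume`), `TorusSobolevNormWeakDerivProofs`
(`mFourierCoeff_eq_of_hasWeakPartialDeriv`, `integral_smul_eq_re_add_I_smul_im` — private copies here, that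
module not being in the farm build closure at the time of writing), `TorusTrigPoly` (`fourierTruncate`,
`mFourierCoeff_fourierTruncate`, `tendsto_eLpNorm_fourierTruncate_sub`), `TorusVectorParseval`
(`hasSum_sq_norm_mFourierCoeff_complexify`, `mFourierCoeff_sub`), `ODE/TorusFlowJacobian`
(`isSmooth_comp_add_proj`, `partialDeriv_comp_add_proj`), `LagrangianLatticeCarrier` (`LevelRegular.isSmooth_disp`,
`LevelRegular.measurePreserving_X`). Mathlib: `eLpNorm_comp_measurePreserving`, `MemLp.comp_measurePreserving`,
`eLpNorm_le_eLpNorm_of_exponent_le`, `tendsto_integral_of_L1`, `LinearIsometry.integral_comp_comm`.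

## References

* L. C. Evans, *Partial Differential Equations*, 2nd ed. (AMS 2010), §5.2.1 (weak derivatives),
  §5.2.3 Thm 1 (local approximation by smooth functions), §5.8 Thm 8 (Fourier characterisation).
  [`Evans2010`]
* W. P. Ziemer, *Weakly Differentiable Functions* (Springer GTM 120, 1989), Thm 2.2.2 (change of
  variables for Sobolev functions). [`Ziemer1989`]
* S. Armstrong, V. Vicol, *Anomalous diffusion by fractal homogenization*, Ann. PDE (2025), §2.2
  (the flows `X_m`, PDF p. 18). [`ArmstrongVicol2025`]
* L. Grafakos, *Classical Fourier Analysis*, 3rd ed. (Springer 2014), Prop. 3.2.7 (Parseval). [`Grafakos2014`]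
-/

noncomputable section

open MeasureTheory Set Filter Function TopologicalSpace UnitAddTorus
open scoped ENNReal NNReal InnerProductSpace Topology

namespace Literature.Analysis.FunctionSpaces

namespace Torus

variable {d : Type*} [Fintype d] [DecidableEq d]

/-! ## Fourier coefficients of weak derivatives (complexified copies) -/

section Coefficients

variable {F : Type*} [NormedAddCommGroup F] [NormedSpace ℂ F]

omit [DecidableEq d] in
/-- Splitting a complex-weighted integral into real and imaginary parts:
`∫ ψ • h = ∫ (Re ψ) • h + i ∫ (Im ψ) • h` for smooth `ψ : T^d → ℂ` and integrable `h` (copy of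
`TorusSobolevNormWeakDerivProofs.integral_smul_eq_re_add_I_smul_im`). [folklore] -/
private theorem integral_smul_eq_re_add_I_smul_im₁₃ {ψ : UnitAddTorus d → ℂ} (hψ : IsSmooth ψ)
    {h : UnitAddTorus d → F} (hh : Integrable h volume) :
    ∫ x, ψ x • h x = (∫ x, (ψ x).re • h x) + Complex.I • ∫ x, (ψ x).im • h x := by
  have hre : IsSmooth fun x => (ψ x).re := hψ.comp_clm Complex.reCLM
  have him : IsSmooth fun x => (ψ x).im := hψ.comp_clm Complex.imCLM
  have h2i : Integrable (fun x => Complex.I • ((ψ x).im • h x)) volume :=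
    (him.integrable_smul hh).smul Complex.I
  rw [← integral_smul, ← integral_add (hre.integrable_smul hh) h2i]
  refine integral_congr_ae (ae_of_all _ fun x => ?_)
  beta_reduce
  calc ψ x • h x = (((ψ x).re : ℂ) + ((ψ x).im : ℂ) * Complex.I) • h x := by rw [Complex.re_add_im]
    _ = ((ψ x).re : ℂ) • h x + Complex.I • (((ψ x).im : ℂ) • h x) := by
        rw [add_smul, mul_comm, mul_smul]
    _ = (ψ x).re • h x + Complex.I • ((ψ x).im • h x) := by
        rw [Complex.coe_smul, Complex.coe_smul]

/-- **Fourier coefficients of a weak derivative** (values in a complex normed space): if `g` is a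
weak `i`-th partial derivative of `f` on `T^d` (both integrable) then `ĝ(n) = 2πi nᵢ f̂(n)` — test the
weak identity with `Re e_{-n}`, `Im e_{-n}` (copy of
`TorusSobolevNormWeakDerivProofs.mFourierCoeff_eq_of_hasWeakPartialDeriv`).
[cite: Evans2010, §5.8 Thm. 8 (Characterization of H^k by Fourier transform) proof step 1] -/
private theorem mFourierCoeff_eq_of_hasWeakPartialDeriv₁₃ {i : d} {f g : UnitAddTorus d → F}
    (hf : Integrable f volume) (hg : Integrable g volume) (h : HasWeakPartialDeriv i f g)
    (n : d → ℤ) :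
    mFourierCoeff g n = (2 * Real.pi * Complex.I * (n i)) • mFourierCoeff f n := by
  have hχ : IsSmooth (⇑(mFourier (-n)) : UnitAddTorus d → ℂ) := isSmooth_mFourier (-n)
  have hre : IsSmooth fun y => (mFourier (-n) y).re := hχ.comp_clm Complex.reCLM
  have him : IsSmooth fun y => (mFourier (-n) y).im := hχ.comp_clm Complex.imCLM
  set c : ℂ := 2 * Real.pi * Complex.I * ((-n) i) with hc
  have hcχ : IsSmooth (fun x => c * mFourier (-n) x) := contDiff_const.mul hχ
  have hdre : ∀ x, partialDeriv i (fun y => (mFourier (-n) y).re) x = (c * mFourier (-n) x).re :=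
    fun x => by
    have h1 := partialDeriv_clm_comp hχ Complex.reCLM i x
    rw [partialDeriv_mFourier] at h1
    exact h1
  have hdim : ∀ x, partialDeriv i (fun y => (mFourier (-n) y).im) x = (c * mFourier (-n) x).im :=
    fun x => by
    have h1 := partialDeriv_clm_comp hχ Complex.imCLM i x
    rw [partialDeriv_mFourier] at h1
    exact h1
  have h1 := h (fun y => (mFourier (-n) y).re) hre
  have h2 := h (fun y => (mFourier (-n) y).im) him
  beta_reduce at h1 h2
  simp_rw [hdre] at h1
  simp_rw [hdim] at h2
  have h1' : ∫ x, (mFourier (-n) x).re • g x = -∫ x, (c * mFourier (-n) x).re • f x := by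
    rw [h1, neg_neg]
  have h2' : ∫ x, (mFourier (-n) x).im • g x = -∫ x, (c * mFourier (-n) x).im • f x := by
    rw [h2, neg_neg]
  calc mFourierCoeff g n = ∫ x, mFourier (-n) x • g x := mFourierCoeff_eq_integral_volume g n
    _ = (∫ x, (mFourier (-n) x).re • g x) + Complex.I • ∫ x, (mFourier (-n) x).im • g x :=
        integral_smul_eq_re_add_I_smul_im₁₃ hχ hg
    _ = -((∫ x, (c * mFourier (-n) x).re • f x) +
          Complex.I • ∫ x, (c * mFourier (-n) x).im • f x) := by
        rw [h1', h2', smul_neg, neg_add]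
    _ = -∫ x, (c * mFourier (-n) x) • f x := by rw [integral_smul_eq_re_add_I_smul_im₁₃ hcχ hf]
    _ = -(c • mFourierCoeff f n) := by
        rw [mFourierCoeff_eq_integral_volume, ← integral_smul]
        congr 1
        refine integral_congr_ae (ae_of_all _ fun x => ?_)
        simp only [smul_smul]
    _ = (2 * Real.pi * Complex.I * (n i)) • mFourierCoeff f n := by
        rw [← neg_smul]
        congr 1
        simp only [hc, Pi.neg_apply, Int.cast_neg]
        ring

end Coefficients

/-! ## Weak derivatives of real vector fields: complexification, truncation, limits -/

section RealFields

/-- Complexification of a weak derivative of a real vector field: the weak identity is `ℝ`-linear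
and `complexify` is an `ℝ`-linear isometry commuting with Bochner integrals. [folklore] -/
private theorem HasWeakPartialDeriv.complexify₁₃ {i : d} {f g : UnitAddTorus d → EuclideanSpace ℝ d}
    (h : HasWeakPartialDeriv i f g) :
    HasWeakPartialDeriv i (EuclideanSpace.complexify ∘ f) (EuclideanSpace.complexify ∘ g) := by
  intro φ hφ
  have e1 : (fun x => partialDeriv i φ x • (EuclideanSpace.complexify ∘ f) x) =
      fun x => EuclideanSpace.complexify (partialDeriv i φ x • f x) := by
    funext x
    simp only [Function.comp_apply, map_smul]
  have e2 : (fun x => φ x • (EuclideanSpace.complexify ∘ g) x) =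
      fun x => EuclideanSpace.complexify (φ x • g x) := by
    funext x
    simp only [Function.comp_apply, map_smul]
  rw [e1, e2, LinearIsometry.integral_comp_comm, LinearIsometry.integral_comp_comm, h φ hφ, map_neg]

/-- **Fourier coefficients of a weak derivative of a real vector field**:
`𝓕(complexify ∘ g)(n) = 2πi nᵢ 𝓕(complexify ∘ f)(n)`.
[cite: Evans2010, §5.8 Thm. 8 (Characterization of H^k by Fourier transform) proof step 1] -/
private theorem mFourierCoeff_complexify_eq_of_hasWeakPartialDeriv₁₃ {i : d}
    {f g : UnitAddTorus d → EuclideanSpace ℝ d} (hf : Integrable f volume) (hg : Integrable g volume)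
    (h : HasWeakPartialDeriv i f g) (n : d → ℤ) :
    mFourierCoeff (EuclideanSpace.complexify ∘ g) n =
      (2 * Real.pi * Complex.I * (n i)) • mFourierCoeff (EuclideanSpace.complexify ∘ f) n := by
  have hf' : Integrable (EuclideanSpace.complexify ∘ f) volume :=
    EuclideanSpace.complexify.toContinuousLinearMap.integrable_comp hf
  have hg' : Integrable (EuclideanSpace.complexify ∘ g) volume :=
    EuclideanSpace.complexify.toContinuousLinearMap.integrable_comp hg
  exact mFourierCoeff_eq_of_hasWeakPartialDeriv₁₃ hf' hg' h.complexify₁₃ n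

omit [DecidableEq d] in
/-- A real vector field in `L²` all of whose complexified Fourier coefficients vanish is `0` a.e.
(Parseval). [cite: Grafakos2014, Prop. 3.2.7 (3)] -/
private theorem ae_eq_zero_of_mFourierCoeff_complexify_eq_zero₁₃ {v : UnitAddTorus d → EuclideanSpace ℝ d}
    (hv : MemLp v 2 volume) (h : ∀ n, mFourierCoeff (EuclideanSpace.complexify ∘ v) n = 0) :
    v =ᵐ[volume] 0 := by
  have hP := hasSum_sq_norm_mFourierCoeff_complexify hv
  simp only [h, norm_zero, ne_eq, OfNat.ofNat_ne_zero, not_false_eq_true, zero_pow] at hP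
  have h0 : ∫ x, ‖v x‖ ^ 2 = 0 := hP.unique hasSum_zero
  have hi : Integrable (fun x => ‖v x‖ ^ 2) volume := (memLp_two_iff_integrable_sq_norm hv.1).1 hv
  have hae := (integral_eq_zero_iff_of_nonneg (fun x => sq_nonneg _) hi).1 h0
  filter_upwards [hae] with x hx
  have : ‖v x‖ ^ 2 = 0 := hx
  rw [Pi.zero_apply, ← norm_eq_zero]
  exact pow_eq_zero_iff two_ne_zero |>.1 this
set_option maxHeartbeats 400000 in -- buildfix (bf3-g31): 160k/180k FAIL, 200k PASS at accept time; line-neutral budget line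
/-- **Derivatives of the Fourier truncations are the truncations of the weak derivatives**: for
`ψ ∈ L²` with weak `i`-th partial derivative `g ∈ L²`, `∂ᵢ(P_N ψ) = P_N g` a.e. (both are the real
trigonometric polynomials with coefficients `2πikᵢ ψ̂(k)`, `|k| ≤ N`).
[cite: Evans2010, §5.8 Thm. 8 (Characterization of H^k by Fourier transform)] -/
private theorem partialDeriv_fourierTruncate_ae_eq₁₃ {i : d} {ψ g : UnitAddTorus d → EuclideanSpace ℝ d}
    (hψ : MemLp ψ 2 volume) (hg : MemLp g 2 volume) (h : HasWeakPartialDeriv i ψ g) (N : ℕ) :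
    partialDeriv i (fourierTruncate N ψ) =ᵐ[volume] fourierTruncate N g := by
  have hPs : IsSmooth (fourierTruncate N ψ) := isSmooth_fourierTruncate N ψ
  have hdP : IsSmooth (partialDeriv i (fourierTruncate N ψ)) := hPs.partialDeriv i
  have hPg : IsSmooth (fourierTruncate N g) := isSmooth_fourierTruncate N g
  have hψi : Integrable ψ volume := hψ.integrable one_le_two
  have hgi : Integrable g volume := hg.integrable one_le_two
  -- coefficients of `∂ᵢ P_N ψ` and of `P_N g`
  have hc1 : ∀ n, mFourierCoeff (EuclideanSpace.complexify ∘ partialDeriv i (fourierTruncate N ψ)) n =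
      (2 * Real.pi * Complex.I * (n i)) • mFourierCoeff (EuclideanSpace.complexify ∘ fourierTruncate N ψ) n :=
    fun n => mFourierCoeff_complexify_eq_of_hasWeakPartialDeriv₁₃ hPs.integrable hdP.integrable
      (IsSmooth.hasWeakPartialDeriv integral_partialDeriv_eq_zero_holds hPs i) n
  have hc2 : ∀ n, mFourierCoeff (EuclideanSpace.complexify ∘ g) n =
      (2 * Real.pi * Complex.I * (n i)) • mFourierCoeff (EuclideanSpace.complexify ∘ ψ) n :=
    fun n => mFourierCoeff_complexify_eq_of_hasWeakPartialDeriv₁₃ hψi hgi h n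
  have hc : ∀ n, mFourierCoeff (EuclideanSpace.complexify ∘ partialDeriv i (fourierTruncate N ψ)) n =
      mFourierCoeff (EuclideanSpace.complexify ∘ fourierTruncate N g) n := by
    intro n
    rw [hc1, mFourierCoeff_fourierTruncate hψi, mFourierCoeff_fourierTruncate hgi]
    split_ifs with hn
    · rw [hc2]
    · rw [smul_zero]
  -- Parseval for the difference
  set v : UnitAddTorus d → EuclideanSpace ℝ d := fun x => partialDeriv i (fourierTruncate N ψ) x - fourierTruncate N g x
    with hv
  have hvmem : MemLp v 2 volume := (hdP.memLp 2).sub (hPg.memLp 2)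
  have hzero : ∀ n, mFourierCoeff (EuclideanSpace.complexify ∘ v) n = 0 := by
    intro n
    have e : EuclideanSpace.complexify ∘ v =
        (EuclideanSpace.complexify ∘ partialDeriv i (fourierTruncate N ψ)) -
          (EuclideanSpace.complexify ∘ fourierTruncate N g) := by
      funext x
      simp only [hv, Function.comp_apply, Pi.sub_apply, map_sub]
    have hi₁ : Integrable (EuclideanSpace.complexify ∘ partialDeriv i (fourierTruncate N ψ)) volume :=
      EuclideanSpace.complexify.toContinuousLinearMap.integrable_comp hdP.integrable
    have hi₂ : Integrable (EuclideanSpace.complexify ∘ fourierTruncate N g) volume :=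
      EuclideanSpace.complexify.toContinuousLinearMap.integrable_comp hPg.integrable
    rw [e, mFourierCoeff_sub hi₁ hi₂, hc n, sub_self]
  have hae := ae_eq_zero_of_mFourierCoeff_complexify_eq_zero₁₃ hvmem hzero
  filter_upwards [hae] with x hx
  rw [hv] at hx
  simpa [sub_eq_zero] using hx

omit [Fintype d] [DecidableEq d] in
/-- **Weak derivatives pass to `L¹` limits**: if `fₙ → f` and `gₙ → g` in `L¹(T^d)` and `gₙ` is a weak
`i`-th partial derivative of `fₙ` for every `n`, then `g` is a weak `i`-th partial derivative of `f`
(smooth test functions and their derivatives are bounded). [cite: Evans2010, §5.2.3 Thm. 1 (proof: passage to the limit in the weak identity)] -/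
private theorem hasWeakPartialDeriv_of_tendsto₁₃ [Fintype d] [DecidableEq d] {i : d}
    {F' : Type*} [NormedAddCommGroup F'] [NormedSpace ℝ F'] [CompleteSpace F']
    {f g : UnitAddTorus d → F'} {fn gn : ℕ → UnitAddTorus d → F'}
    (hf : Integrable f volume) (hg : Integrable g volume)
    (hfn : ∀ n, Integrable (fn n) volume) (hgn : ∀ n, Integrable (gn n) volume)
    (hlimf : Tendsto (fun n => ∫⁻ x, ‖fn n x - f x‖ₑ) atTop (𝓝 0))
    (hlimg : Tendsto (fun n => ∫⁻ x, ‖gn n x - g x‖ₑ) atTop (𝓝 0))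
    (h : ∀ n, HasWeakPartialDeriv i (fn n) (gn n)) : HasWeakPartialDeriv i f g := by
  intro φ hφ
  -- a bounded smooth weight does not spoil `L¹` convergence
  have key : ∀ {θ : UnitAddTorus d → ℝ}, IsSmooth θ → ∀ {u : UnitAddTorus d → F'} {un : ℕ → UnitAddTorus d → F'},
      Integrable u volume → (∀ n, Integrable (un n) volume) →
      Tendsto (fun n => ∫⁻ x, ‖un n x - u x‖ₑ) atTop (𝓝 0) →
      Tendsto (fun n => ∫ x, θ x • un n x) atTop (𝓝 (∫ x, θ x • u x)) := by
    intro θ hθ u un hu hun hlim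
    obtain ⟨C, hC⟩ := (isCompact_univ.image hθ.continuous).isBounded.exists_norm_le
    have hC' : ∀ x, ‖θ x‖ ≤ C := fun x => hC _ ⟨x, mem_univ _, rfl⟩
    have hC0 : 0 ≤ C := (norm_nonneg _).trans (hC' 0)
    refine tendsto_integral_of_L1 _ (hθ.integrable_smul hu).aestronglyMeasurable
      (Eventually.of_forall fun n => hθ.integrable_smul (hun n)) ?_
    have hbd : ∀ n, ∫⁻ x, ‖θ x • un n x - θ x • u x‖ₑ ≤ ENNReal.ofReal C * ∫⁻ x, ‖un n x - u x‖ₑ := by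
      intro n
      rw [← lintegral_const_mul' _ _ ENNReal.ofReal_ne_top]
      refine lintegral_mono fun x => ?_
      rw [← smul_sub, enorm_smul, ← ofReal_norm (θ x)]
      gcongr
      exact hC' x
    have h0 : Tendsto (fun n => ENNReal.ofReal C * ∫⁻ x, ‖un n x - u x‖ₑ) atTop (𝓝 0) := by
      have := ENNReal.Tendsto.const_mul (a := ENNReal.ofReal C) hlim (Or.inr ENNReal.ofReal_ne_top)
      rwa [mul_zero] at this
    exact tendsto_of_tendsto_of_tendsto_of_le_of_le tendsto_const_nhds h0 (fun _ => zero_le) hbd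
  have t1 := key (hφ.partialDeriv i) hf hfn hlimf
  have t2 := (key hφ hg hgn hlimg).neg
  have e : ∀ n, ∫ x, partialDeriv i φ x • fn n x = -∫ x, φ x • gn n x := fun n => h n φ hφ
  exact tendsto_nhds_unique (t1.congr e) t2

omit [DecidableEq d] in
/-- From `L²` to `L¹` convergence on the (probability) torus. [folklore] -/
private theorem tendsto_lintegral_enorm_of_tendsto_eLpNorm_two₁₃ {F' : Type*} [NormedAddCommGroup F']
    {u : ℕ → UnitAddTorus d → F'} (hu : ∀ n, AEStronglyMeasurable (u n) volume)
    (h : Tendsto (fun n => eLpNorm (u n) 2 volume) atTop (𝓝 0)) :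
    Tendsto (fun n => ∫⁻ x, ‖u n x‖ₑ) atTop (𝓝 0) := by
  refine tendsto_of_tendsto_of_tendsto_of_le_of_le tendsto_const_nhds h (fun _ => zero_le) fun n => ?_
  rw [← eLpNorm_one_eq_lintegral_enorm]
  exact eLpNorm_le_eLpNorm_of_exponent_le one_le_two (hu n)

end RealFields

/-! ## The chain rule through `X = id + proj ∘ D` -/

section ChainRule

omit [DecidableEq d] in
/-- **`ψ ∘ X ∈ L^p`** for `ψ ∈ L^p` and a measure-preserving torus self-map `X y = y + proj (D y)`.
[cite: Evans2010, §5.2.3 Thm. 1] -/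
theorem memLp_comp_add_proj {D : UnitAddTorus d → EuclideanSpace ℝ d}
    (hX : MeasurePreserving (fun y => y + proj (D y)) volume volume)
    {F' : Type*} [NormedAddCommGroup F'] {ψ : UnitAddTorus d → F'} {p : ℝ≥0∞} (hψ : MemLp ψ p volume) :
    MemLp (fun y => ψ (y + proj (D y))) p volume :=
  hψ.comp_measurePreserving hX

/-- The smooth case of the chain rule, in weak form: for smooth `ψ` and smooth `D`,
`y ↦ Σₐ (δ_{aj} + ∂ⱼDₐ(y)) • ∂ₐψ(X y)` is a weak `j`-th partial derivative of `ψ ∘ X`, `X = id + proj ∘ D`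
(classical chain rule `TorusFlow.partialDeriv_comp_add_proj` and integration by parts).
[cite: Evans2010, §5.2.1 (motivation of the definition)] -/
private theorem hasWeakPartialDeriv_comp_add_proj_smooth₁₃ {F' : Type*} [NormedAddCommGroup F']
    [NormedSpace ℝ F'] [CompleteSpace F'] {ψ : UnitAddTorus d → F'} (hψ : IsSmooth ψ)
    {D : UnitAddTorus d → EuclideanSpace ℝ d} (hD : IsSmooth D) (j : d) :
    HasWeakPartialDeriv j (fun y => ψ (y + proj (D y)))
      (fun y => ∑ a, ((EuclideanSpace.single j (1 : ℝ)) a + (partialDeriv j D y) a) •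
        partialDeriv a ψ (y + proj (D y))) := by
  have hs : IsSmooth (fun y => ψ (y + proj (D y))) := ODE.TorusFlow.isSmooth_comp_add_proj hψ hD
  have h := IsSmooth.hasWeakPartialDeriv integral_partialDeriv_eq_zero_holds hs j
  have e : partialDeriv j (fun y => ψ (y + proj (D y))) =
      fun y => ∑ a, ((EuclideanSpace.single j (1 : ℝ)) a + (partialDeriv j D y) a) •
        partialDeriv a ψ (y + proj (D y)) :=
    funext fun y => ODE.TorusFlow.partialDeriv_comp_add_proj (hψ.isContDiff (by simp)) (hD.isContDiff (by simp)) j y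
  rw [e] at h
  exact h

/-- **The `H¹` chain rule on the torus through a smooth measure-preserving self-map.** Let
`D : 𝕋^d → ℝ^d` be smooth and `X y = y + proj (D y)` measure preserving; let `ψ ∈ L²(𝕋^d; ℝ^d)` have
the weak partial derivatives `gₐ ∈ L²`, `a ∈ d`. Then, for every `j`,
`y ↦ Σₐ (δ_{aj} + ∂ⱼDₐ(y)) • gₐ(X y)` is a weak `j`-th partial derivative of `ψ ∘ X` — the classical
chain rule `∂ⱼ(ψ ∘ X) = Σₐ ∂ⱼXₐ · (∂ₐψ) ∘ X` in weak form. Proof by approximation (Evans §5.2.3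
Thm 1): `P_Nψ → ψ`, `∂ₐP_Nψ = P_N gₐ → gₐ` in `L²`; classical chain rule for `P_Nψ ∘ X`; composition
with `X` is an `L²`-isometry and `∂ⱼD` is bounded, so the weak identity passes to the limit.
[cite: Evans2010, §5.2.3 Thm. 1 and §5.8 Thm. 8] [cite: Ziemer1989, Thm. 2.2.2] -/
theorem HasWeakPartialDeriv.comp_add_proj {D : UnitAddTorus d → EuclideanSpace ℝ d} (hD : IsSmooth D)
    (hX : MeasurePreserving (fun y => y + proj (D y)) volume volume)
    {ψ : UnitAddTorus d → EuclideanSpace ℝ d} {g : d → UnitAddTorus d → EuclideanSpace ℝ d}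
    (hψ : MemLp ψ 2 volume) (hg : ∀ a, MemLp (g a) 2 volume) (hw : ∀ a, HasWeakPartialDeriv a ψ (g a))
    (j : d) :
    HasWeakPartialDeriv j (fun y => ψ (y + proj (D y)))
      (fun y => ∑ a, ((EuclideanSpace.single j (1 : ℝ)) a + (partialDeriv j D y) a) • g a (y + proj (D y))) := by
  set X : UnitAddTorus d → UnitAddTorus d := fun y => y + proj (D y) with hXdef
  set c : d → UnitAddTorus d → ℝ := fun a y => (EuclideanSpace.single j (1 : ℝ)) a + (partialDeriv j D y) a
    with hc
  -- the coefficients are continuous and bounded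
  have hc_cont : ∀ a, Continuous (c a) := fun a =>
    continuous_const.add ((EuclideanSpace.proj a).continuous.comp (hD.partialDeriv j).continuous)
  have hc_bdd : ∀ a, ∃ C : ℝ, ∀ y, ‖c a y‖ ≤ C := by
    intro a
    obtain ⟨C, hC⟩ := (isCompact_univ.image (hc_cont a)).isBounded.exists_norm_le
    exact ⟨C, fun y => hC _ ⟨y, mem_univ _, rfl⟩⟩
  choose C hC using hc_bdd
  -- the approximants and their weak derivatives through `X`
  set ψN : ℕ → UnitAddTorus d → EuclideanSpace ℝ d := fun N => fourierTruncate N ψ with hψN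
  have hψNs : ∀ N, IsSmooth (ψN N) := fun N => isSmooth_fourierTruncate N ψ
  set GN : ℕ → UnitAddTorus d → EuclideanSpace ℝ d := fun N y =>
    ∑ a, c a y • partialDeriv a (ψN N) (X y) with hGN
  set G : UnitAddTorus d → EuclideanSpace ℝ d := fun y => ∑ a, c a y • g a (X y) with hG
  have hsmooth : ∀ N, HasWeakPartialDeriv j (fun y => ψN N (X y)) (GN N) := fun N =>
    hasWeakPartialDeriv_comp_add_proj_smooth₁₃ (hψNs N) hD j
  -- integrability
  have hψi : Integrable ψ volume := hψ.integrable one_le_two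
  have hgi : ∀ a, Integrable (g a) volume := fun a => (hg a).integrable one_le_two
  have hf : Integrable (fun y => ψ (X y)) volume := (hψ.comp_measurePreserving hX).integrable one_le_two
  have hfn : ∀ N, Integrable (fun y => ψN N (X y)) volume := fun N =>
    (ODE.TorusFlow.isSmooth_comp_add_proj (hψNs N) hD).integrable
  have hgX : ∀ a, Integrable (fun y => g a (X y)) volume := fun a =>
    ((hg a).comp_measurePreserving hX).integrable one_le_two
  have hterm : ∀ a, Integrable (fun y => c a y • g a (X y)) volume := fun a =>
    (hgX a).bdd_smul (C a) (hc_cont a).aestronglyMeasurable (ae_of_all _ (hC a))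
  have hGi : Integrable G volume := by
    have : G = fun y => ∑ a ∈ Finset.univ, c a y • g a (X y) := rfl
    rw [this]
    exact integrable_finsetSum _ fun a _ => hterm a
  have hdψNX : ∀ N a, Integrable (fun y => partialDeriv a (ψN N) (X y)) volume := fun N a =>
    (ODE.TorusFlow.isSmooth_comp_add_proj ((hψNs N).partialDeriv a) hD).integrable
  have htermN : ∀ N a, Integrable (fun y => c a y • partialDeriv a (ψN N) (X y)) volume := fun N a =>
    (hdψNX N a).bdd_smul (C a) (hc_cont a).aestronglyMeasurable (ae_of_all _ (hC a))
  have hGNi : ∀ N, Integrable (GN N) volume := by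
    intro N
    have : GN N = fun y => ∑ a ∈ Finset.univ, c a y • partialDeriv a (ψN N) (X y) := rfl
    rw [this]
    exact integrable_finsetSum _ fun a _ => htermN N a
  -- `L¹` convergence of the approximants composed with `X`
  have hlimf : Tendsto (fun N => ∫⁻ y, ‖ψN N (X y) - ψ (X y)‖ₑ) atTop (𝓝 0) := by
    have h2 : Tendsto (fun N => eLpNorm (fun y => ψN N (X y) - ψ (X y)) 2 volume) atTop (𝓝 0) := by
      refine (tendsto_eLpNorm_fourierTruncate_sub hψ).congr fun N => ?_
      have hm : AEStronglyMeasurable (fourierTruncate N ψ - ψ) volume :=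
        (hψNs N).continuous.aestronglyMeasurable.sub hψ.1
      rw [← eLpNorm_comp_measurePreserving hm hX]
      rfl
    exact tendsto_lintegral_enorm_of_tendsto_eLpNorm_two₁₃
      (fun N => (hfn N).aestronglyMeasurable.sub hf.aestronglyMeasurable) h2
  -- `L¹` convergence of the weak derivatives
  have hlimg : Tendsto (fun N => ∫⁻ y, ‖GN N y - G y‖ₑ) atTop (𝓝 0) := by
    -- per component: `∂ₐ P_N ψ ∘ X → gₐ ∘ X` in `L²`
    have hcomp : ∀ a, Tendsto (fun N => eLpNorm (fun y => partialDeriv a (ψN N) (X y) - g a (X y)) 2 volume)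
        atTop (𝓝 0) := by
      intro a
      refine (tendsto_eLpNorm_fourierTruncate_sub (hg a)).congr fun N => ?_
      have hm : AEStronglyMeasurable (fourierTruncate N (g a) - g a) volume :=
        (isSmooth_fourierTruncate N (g a)).continuous.aestronglyMeasurable.sub (hg a).1
      rw [← eLpNorm_comp_measurePreserving hm hX]
      -- replace `P_N gₐ` by `∂ₐ P_N ψ` (a.e. equal), after composition with the measure-preserving `X`
      refine eLpNorm_congr_ae ?_
      have hae := partialDeriv_fourierTruncate_ae_eq₁₃ hψ (hg a) (hw a) N
      have hae' := hX.quasiMeasurePreserving.ae_eq_comp hae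
      filter_upwards [hae'] with y hy
      simp only [Function.comp_apply, Pi.sub_apply] at hy ⊢
      rw [← hy]
    have hcomp1 : ∀ a, Tendsto (fun N => ∫⁻ y, ‖partialDeriv a (ψN N) (X y) - g a (X y)‖ₑ) atTop (𝓝 0) :=
      fun a => tendsto_lintegral_enorm_of_tendsto_eLpNorm_two₁₃
        (fun N => (hdψNX N a).aestronglyMeasurable.sub (hgX a).aestronglyMeasurable) (hcomp a)
    -- sum over components with the bounded weights
    have hbd : ∀ N, ∫⁻ y, ‖GN N y - G y‖ₑ ≤
        ∑ a, ENNReal.ofReal (C a) * ∫⁻ y, ‖partialDeriv a (ψN N) (X y) - g a (X y)‖ₑ := by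
      intro N
      have e : ∀ y, GN N y - G y = ∑ a, c a y • (partialDeriv a (ψN N) (X y) - g a (X y)) := by
        intro y
        simp only [hGN, hG, smul_sub, Finset.sum_sub_distrib]
      calc ∫⁻ y, ‖GN N y - G y‖ₑ
          ≤ ∫⁻ y, ∑ a, ENNReal.ofReal (C a) * ‖partialDeriv a (ψN N) (X y) - g a (X y)‖ₑ := by
            refine lintegral_mono fun y => ?_
            rw [e y]
            refine (enorm_sum_le _ _).trans (Finset.sum_le_sum fun a _ => ?_)
            rw [enorm_smul, ← ofReal_norm (c a y)]
            gcongr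
            exact hC a y
        _ = ∑ a, ENNReal.ofReal (C a) * ∫⁻ y, ‖partialDeriv a (ψN N) (X y) - g a (X y)‖ₑ := by
            rw [lintegral_finsetSum' _ fun a _ => ?_]
            · exact Finset.sum_congr rfl fun a _ => lintegral_const_mul' _ _ ENNReal.ofReal_ne_top
            · exact (((hdψNX N a).sub (hgX a)).aestronglyMeasurable.enorm.const_mul _)
    have h0 : Tendsto (fun N => ∑ a, ENNReal.ofReal (C a) * ∫⁻ y, ‖partialDeriv a (ψN N) (X y) - g a (X y)‖ₑ)
        atTop (𝓝 0) := by
      have : (0 : ℝ≥0∞) = ∑ a : d, ENNReal.ofReal (C a) * 0 := by simp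
      rw [this]
      refine tendsto_finsetSum _ fun a _ => ?_
      exact ENNReal.Tendsto.const_mul (hcomp1 a) (Or.inr ENNReal.ofReal_ne_top)
    exact tendsto_of_tendsto_of_tendsto_of_le_of_le tendsto_const_nhds h0 (fun _ => zero_le) hbd
  exact hasWeakPartialDeriv_of_tendsto₁₃ hf hGi hfn hGNi hlimf hlimg hsmooth

end ChainRule

end Torus

end Literature.Analysis.FunctionSpaces

/-! ## The instance for the window flows of a regular Lagrangian lattice carrier -/

namespace Literature.Analysis.FluidPDE.LatticeShear.LagrangianLatticeCarrier

open Literature.Analysis.FunctionSpaces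

/-- **`H¹` chain rule under the coarse window flow of a regular Lagrangian lattice carrier** (brick Z5
of the one-level design memo L7/L8, `frameChainRule_text`, in its binder shape): for `E.Regular`, the
flow map `E.X m t s = id + proj ∘ E.disp m t s` is smooth and measure preserving, so for `ψ ∈ L²(𝕋³; ℝ³)`
with weak partial derivatives `gⱼ ∈ L²`, `ψ ∘ E.X m t s ∈ L²` and its weak `j`-th partial derivative is
`y ↦ Σₐ (E.flowDeriv m t s y eⱼ)ₐ • gₐ (E.X m t s y)` (`E.flowDeriv m t s y = 1 + D(lift disp)(repr y)`
is the derivative `DX(y)`; `(DX(y) eⱼ)ₐ = ∂ⱼXₐ(y)`).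
[cite: ArmstrongVicol2025, §2.2 (PDF p. 18: the flows X_m and their distortion ∇X_m)] [cite: Evans2010, §5.2.3 Thm. 1] -/
theorem frameChainRule : ∀ k (E : LagrangianLatticeCarrier k), E.Regular →
    ∀ (m : ℕ) (t s : ℝ) (ψ : UnitAddTorus (Fin 3) → EuclideanSpace ℝ (Fin 3))
      (g : Fin 3 → UnitAddTorus (Fin 3) → EuclideanSpace ℝ (Fin 3)),
      MemLp ψ 2 volume → (∀ j, MemLp (g j) 2 volume) → (∀ j, Torus.HasWeakPartialDeriv j ψ (g j)) →
      MemLp (fun y => ψ (E.X m t s y)) 2 volume ∧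
      ∀ j, Torus.HasWeakPartialDeriv j (fun y => ψ (E.X m t s y))
        (fun y => ∑ a, (E.flowDeriv m t s y (EuclideanSpace.single j (1:ℝ))) a • g a (E.X m t s y)) := by
  intro k E hE m t s ψ g hψ hg hw
  have hD : Torus.IsSmooth (E.disp m t s) := hE.levelRegular.isSmooth_disp m t s
  have hX : MeasurePreserving (fun y => y + Torus.proj (E.disp m t s y)) volume volume :=
    hE.levelRegular.measurePreserving_X m t s
  refine ⟨Torus.memLp_comp_add_proj hX hψ, fun j => ?_⟩
  have h := Torus.HasWeakPartialDeriv.comp_add_proj hD hX hψ hg hw j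
  have hfd : ∀ y (a : Fin 3), (E.flowDeriv m t s y (EuclideanSpace.single j (1:ℝ))) a =
      (EuclideanSpace.single j (1:ℝ)) a + (Torus.partialDeriv j (E.disp m t s) y) a := by
    intro y a
    rw [flowDeriv, _root_.add_apply, ContinuousLinearMap.id_apply, Torus.fderiv_lift, Torus.proj_repr,
      ← Torus.partialDeriv_eq_fderiv_apply (hD.isContDiff (by simp)), PiLp.add_apply]
  have e : (fun y => ∑ a, (E.flowDeriv m t s y (EuclideanSpace.single j (1:ℝ))) a • g a (E.X m t s y)) =
      fun y => ∑ a, ((EuclideanSpace.single j (1:ℝ)) a + (Torus.partialDeriv j (E.disp m t s) y) a) •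
        g a (y + Torus.proj (E.disp m t s y)) := by
    funext y
    exact Finset.sum_congr rfl fun a _ => by rw [hfd y a]; rfl
  rw [e]
  exact h

end Literature.Analysis.FluidPDE.LatticeShear.LagrangianLatticeCarrier

end
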